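import Mathlib
import HarnessLib
import Literature.MathematicalPhysics.QuantumLattice.FinDimSpectrumProofs
import Literature.MathematicalPhysics.QuantumLattice.FinDimSpectrumSpectralGapProofs
import Literature.MathematicalPhysics.QuantumLattice.GroundStateSourceBounds
import Summits.HubbardSuperconductivity.HubbardSuperconductivity.Theorems.ChiralWindowCwChiralConstructionSecondOrderEnergyBoundsLemmas

/-!
# Crux `CwChiralConstruction` (stmt-HubbardSuperconductivity-1740), line `susceptibility-rise-budget`:
# stub `stub_secondOrderEnergyBounds`

Two-sided SECOND-ORDER PERTURBATION BOUNDS for the ground energy of a Hermitian matrix `K` with a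
unique gapped ground state (`K.HasSpectralGap g`: simple ground eigenvalue `E₀`, unit ground vector
`ψ`, all other eigenvalues `≥ E₀ + g`; the tracial ground state is the vector state
`ω = ⟨ψ, · ψ⟩`). With the REDUCED RESOLVENT `R = Σ_{λ ≠ E₀} (λ - E₀)⁻¹ P_λ` (here
`hK.cfc (x ↦ (x - E₀)⁻¹)`, companion file `…SecondOrderEnergyBoundsLemmas`):

* state-level clauses `0 ≤ ω(XᴴRX) ≤ (ω(XᴴX) - |ω X|²)/g` (`0 ≤ R ≤ g⁻¹(1 - |ψ⟩⟨ψ|)`) and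
  `ω(XᴴR²X) ≤ ω(XᴴRX)/g` (`R² ≤ g⁻¹R`);
* LOWER bound `E₀ - ω(B) - (g/(g - 2‖B‖)) ω(BRB) ≤ E₀(K - B)` for Hermitian `B`, `2‖B‖ < g`:
  for `χ = αψ + φ`, `φ ⊥ ψ`, `⟨χ,(K-B)χ⟩ - (E₀ - b - cq)‖χ‖² ≥ cq|α|² + ⟨φ,Mφ⟩ - 2Re(α⟨φ,δ⟩) ≥ 0`
  with `b = ω(B) ≥ -‖B‖`, `⟨φ,Bφ⟩ ≤ ‖B‖‖φ‖²`, `δ = Bψ - bψ`, the shifted operator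
  `M = K - E₀ - 2‖B‖ + 2‖B‖|ψ⟩⟨ψ| ≥ 0`, its partial inverse `S` (`MS = 1 - |ψ⟩⟨ψ|`,
  `S ≤ cR`, `c = g/(g - 2‖B‖)`) and the completed square `⟨φ - αSδ, M(φ - αSδ)⟩ ≥ 0`;
* UPPER bound `E₀(K - B) ≤ E₀ - (ω(B) + ω(BRB) - ‖B‖ω(BR²B))/(1 + ω(BR²B))`: the trial vector
  `ψ + RBψ` (`(K - E₀)R = 1 - |ψ⟩⟨ψ|`, `Rψ = 0`) in the variational principle.

Folklore (Rayleigh–Schrödinger / Kato, *Perturbation theory for linear operators* §II.2, Temple-type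
bounds; Reed–Simon IV §XIII.1). No definitions, no named facts; everything is proved.
-/

set_option linter.dupNamespace false

namespace Summit.HubbardSuperconductivity.HubbardSuperconductivity.Theorems

open Literature.MathematicalPhysics.QuantumLattice Matrix
open scoped Matrix.Norms.L2Operator ComplexOrder

namespace CwSecondOrder

variable {n : Type*} [Fintype n] [DecidableEq n] {K : Matrix n n ℂ} (hK : K.IsHermitian)

section Shifted

variable {g : ℝ} {i₀ : n}

/-! ### The shifted operator `K - E₀ - 2β + 2β P₀` and its partial inverse -/

/-- `K - E₀ - 2β + 2β|ψ⟩⟨ψ| ≥ 0` for `2β < g`. [folklore] -/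
theorem posSemidef_shifted (hg : 0 < g) (hi₀ : hK.eigenvalues i₀ = K.groundEnergy)
    (hgap' : ∀ i, i ≠ i₀ → K.groundEnergy + g ≤ hK.eigenvalues i) {β : ℝ} (hβg : 2 * β < g) :
    (hK.cfc fun x => x - K.groundEnergy - 2 * β +
      2 * β * (if x = K.groundEnergy then 1 else 0)).PosSemidef := by
  refine posSemidef_cfc hK fun i => ?_
  by_cases hi : i = i₀
  · subst hi
    rw [hi₀, if_pos rfl]
    ring_nf
    rfl
  · have h1 := hgap' i hi
    rw [if_neg (eigenvalues_ne_groundEnergy hK hg hgap' hi)]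
    linarith

/-- The shifted operator as a matrix: `K - (E₀ + 2β)·1 + 2β |ψ⟩⟨ψ|`. [folklore] -/
theorem shifted_eq (hg : 0 < g) (hi₀ : hK.eigenvalues i₀ = K.groundEnergy)
    (hgap' : ∀ i, i ≠ i₀ → K.groundEnergy + g ≤ hK.eigenvalues i) (β : ℝ) :
    hK.cfc (fun x => x - K.groundEnergy - 2 * β + 2 * β * (if x = K.groundEnergy then 1 else 0)) =
      K - ((K.groundEnergy + 2 * β : ℝ) : ℂ) • (1 : Matrix n n ℂ) +
        ((2 * β : ℝ) : ℂ) • vecMulVec ⇑(hK.eigenvectorBasis i₀) (star ⇑(hK.eigenvectorBasis i₀)) := by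
  have h : hK.cfc (fun x => x - K.groundEnergy - 2 * β +
      2 * β * (if x = K.groundEnergy then 1 else 0)) =
      hK.cfc (fun x => x) - ((K.groundEnergy + 2 * β : ℝ) : ℂ) • (1 : Matrix n n ℂ) +
        ((2 * β : ℝ) : ℂ) •
          vecMulVec ⇑(hK.eigenvectorBasis i₀) (star ⇑(hK.eigenvectorBasis i₀)) := by
    rw [vecMulVec_eq_cfc hK hg hi₀ hgap', ← cfc_one hK, cfc_smul, cfc_smul, cfc_sub, cfc_add]
    refine cfc_congr hK fun i => ?_
    simp only [Pi.add_apply, Pi.sub_apply, Pi.smul_apply, smul_eq_mul]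
    ring
  rwa [cfc_id hK] at h

/-- `M S = 1 - |ψ⟩⟨ψ|` for the shifted operator `M` and its partial inverse `S`. [folklore] -/
theorem shifted_mul_partialInv (hg : 0 < g) (hi₀ : hK.eigenvalues i₀ = K.groundEnergy)
    (hgap' : ∀ i, i ≠ i₀ → K.groundEnergy + g ≤ hK.eigenvalues i) {β : ℝ} (hβg : 2 * β < g) :
    hK.cfc (fun x => x - K.groundEnergy - 2 * β + 2 * β * (if x = K.groundEnergy then 1 else 0)) *
        hK.cfc (fun x => if x = K.groundEnergy then 0 else (x - K.groundEnergy - 2 * β)⁻¹) =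
      1 - vecMulVec ⇑(hK.eigenvectorBasis i₀) (star ⇑(hK.eigenvectorBasis i₀)) := by
  rw [cfc_mul, vecMulVec_eq_cfc hK hg hi₀ hgap', ← cfc_one hK, cfc_sub]
  refine cfc_congr hK fun i => ?_
  simp only [Pi.mul_apply, Pi.sub_apply]
  by_cases hi : i = i₀
  · subst hi
    simp [hi₀]
  · have h1 := hgap' i hi
    have hne := eigenvalues_ne_groundEnergy hK hg hgap' hi
    simp only [if_neg hne, mul_zero, add_zero, sub_zero]
    have hd : hK.eigenvalues i - K.groundEnergy - 2 * β ≠ 0 := by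
      intro h0; linarith
    exact mul_inv_cancel₀ hd

/-- `S ≤ (g/(g - 2β)) R` for `0 ≤ β`, `2β < g`. [folklore] -/
theorem posSemidef_smul_resolvent_sub_partialInv (hg : 0 < g)
    (hi₀ : hK.eigenvalues i₀ = K.groundEnergy)
    (hgap' : ∀ i, i ≠ i₀ → K.groundEnergy + g ≤ hK.eigenvalues i) {β : ℝ} (hβ : 0 ≤ β)
    (hβg : 2 * β < g) :
    ((((g / (g - 2 * β)) : ℝ) : ℂ) • hK.cfc (fun x => (x - K.groundEnergy)⁻¹) -
      hK.cfc (fun x => if x = K.groundEnergy then 0 else (x - K.groundEnergy - 2 * β)⁻¹)).PosSemidef := by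
  rw [cfc_smul, cfc_sub]
  refine posSemidef_cfc hK fun i => ?_
  simp only [Pi.sub_apply, Pi.smul_apply, smul_eq_mul]
  by_cases hi : i = i₀
  · subst hi
    rw [hi₀, if_pos rfl, sub_self, _root_.inv_zero, mul_zero, sub_zero]
  · have h1 := hgap' i hi
    rw [if_neg (eigenvalues_ne_groundEnergy hK hg hgap' hi), sub_nonneg]
    have hd : 0 < hK.eigenvalues i - K.groundEnergy := by linarith
    have hd2 : 0 < hK.eigenvalues i - K.groundEnergy - 2 * β := by linarith
    have hg2 : 0 < g - 2 * β := by linarith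
    rw [← one_div, ← div_eq_mul_inv, div_le_div_iff₀ hd2 hd, one_mul, div_mul_eq_mul_div,
      le_div_iff₀ hg2]
    nlinarith

end Shifted

/-! ### The state-level clauses -/

section Clauses

variable {g : ℝ} {i₀ : n}

/-- Clause `0 ≤ Re ω(Xᴴ R X)`: `Xᴴ R X ≥ 0` and the tracial ground state is positive. [folklore] -/
theorem re_conj_resolvent_nonneg (X : Matrix n n ℂ) :
    0 ≤ (K.groundStateFunctional (Xᴴ * hK.cfc (fun x => (x - K.groundEnergy)⁻¹) * X)).re :=
  (Complex.nonneg_iff.mp (groundStateFunctional_nonneg_of_posSemidef K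
    ((posSemidef_resolvent hK).conjTranspose_mul_mul_same X))).1

/-- Clause `Re ω(Xᴴ R X) ≤ (Re ω(Xᴴ X) - |ω X|²)/g` (from `1 - gR - |ψ⟩⟨ψ| ≥ 0` and
`ω(Xᴴ |ψ⟩⟨ψ| X) = |ω X|²`). [folklore] -/
theorem re_conj_resolvent_le {R : Matrix n n ℂ} (hR : R = hK.cfc (fun x => (x - K.groundEnergy)⁻¹))
    (hg : 0 < g) (hi₀ : hK.eigenvalues i₀ = K.groundEnergy)
    (hgap' : ∀ i, i ≠ i₀ → K.groundEnergy + g ≤ hK.eigenvalues i)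
    (hω : ∀ X, K.groundStateFunctional X =
      star ⇑(hK.eigenvectorBasis i₀) ⬝ᵥ (X *ᵥ ⇑(hK.eigenvectorBasis i₀)))
    (X : Matrix n n ℂ) :
    (K.groundStateFunctional (Xᴴ * R * X)).re ≤
      ((K.groundStateFunctional (Xᴴ * X)).re - ‖K.groundStateFunctional X‖ ^ 2) / g := by
  subst hR
  set ψ : n → ℂ := ⇑(hK.eigenvectorBasis i₀) with hψ
  set P := vecMulVec ψ (star ψ) with hPdef
  have hD := posSemidef_one_sub_resolvent hK hg hi₀ hgap'
  have h0 := groundStateFunctional_nonneg_of_posSemidef K (hD.conjTranspose_mul_mul_same X)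
  rw [Matrix.mul_sub, Matrix.mul_sub, Matrix.mul_one, Matrix.mul_smul, Matrix.sub_mul,
    Matrix.sub_mul, Matrix.smul_mul, map_sub, map_sub, map_smul] at h0
  have hPX : K.groundStateFunctional (Xᴴ * P * X) =
      ((‖K.groundStateFunctional X‖ ^ 2 : ℝ) : ℂ) := by
    rw [hω (Xᴴ * P * X), ← mulVec_mulVec, ← mulVec_mulVec, hPdef, vecMulVec_mulVec,
      op_smul_eq_smul, mulVec_smul, dotProduct_smul, smul_eq_mul, ← hω X, ← hω Xᴴ,
      groundStateFunctional_conjTranspose, Complex.star_def, Complex.mul_conj,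
      Complex.normSq_eq_norm_sq]
  rw [hPX] at h0
  obtain ⟨hre, -⟩ := Complex.nonneg_iff.mp h0
  simp only [Complex.sub_re, smul_eq_mul, Complex.re_ofReal_mul, Complex.ofReal_re] at hre
  rw [le_div_iff₀ hg]
  linarith

/-- Clause `Re ω(Xᴴ R² X) ≤ Re ω(Xᴴ R X)/g` (from `R² ≤ g⁻¹ R`). [folklore] -/
theorem re_conj_resolvent_sq_le {R : Matrix n n ℂ} (hR : R = hK.cfc (fun x => (x - K.groundEnergy)⁻¹))
    (hg : 0 < g) (hi₀ : hK.eigenvalues i₀ = K.groundEnergy)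
    (hgap' : ∀ i, i ≠ i₀ → K.groundEnergy + g ≤ hK.eigenvalues i) (X : Matrix n n ℂ) :
    (K.groundStateFunctional (Xᴴ * R * R * X)).re ≤
      (K.groundStateFunctional (Xᴴ * R * X)).re / g := by
  subst hR
  have hD := posSemidef_resolvent_sub_sq hK hg hi₀ hgap'
  have h0 := groundStateFunctional_nonneg_of_posSemidef K (hD.conjTranspose_mul_mul_same X)
  rw [Matrix.mul_sub, Matrix.mul_smul, Matrix.sub_mul, Matrix.smul_mul, ← Matrix.mul_assoc Xᴴ,
    map_sub, map_smul] at h0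
  obtain ⟨hre, -⟩ := Complex.nonneg_iff.mp h0
  simp only [Complex.sub_re, smul_eq_mul, Complex.re_ofReal_mul] at hre
  rw [div_eq_inv_mul]
  linarith

/-- **Lower bound** `E₀ - ω(B) - (g/(g-2‖B‖)) ω(BRB) ≤ E₀(K - B)` for Hermitian `B` with
`2‖B‖ < g`: completion of the square on `ψ⊥` with the shifted operator
`M = K - E₀ - 2‖B‖ + 2‖B‖ |ψ⟩⟨ψ| ≥ 0` and its partial inverse `S ≤ (g/(g-2‖B‖)) R`. [folklore] -/
theorem lower_bound [Nonempty n] {R : Matrix n n ℂ} (hR : R = hK.cfc (fun x => (x - K.groundEnergy)⁻¹))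
    (hg : 0 < g) (hi₀ : hK.eigenvalues i₀ = K.groundEnergy)
    (hgap' : ∀ i, i ≠ i₀ → K.groundEnergy + g ≤ hK.eigenvalues i)
    (hω : ∀ X, K.groundStateFunctional X =
      star ⇑(hK.eigenvectorBasis i₀) ⬝ᵥ (X *ᵥ ⇑(hK.eigenvectorBasis i₀)))
    {B : Matrix n n ℂ} (hB : B.IsHermitian) (hBg : 2 * ‖B‖ < g) :
    K.groundEnergy - (K.groundStateFunctional B).re -
        g / (g - 2 * ‖B‖) * (K.groundStateFunctional (B * R * B)).re ≤ (K - B).groundEnergy := by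
  subst hR
  set E₀ := K.groundEnergy with hE₀
  set β := ‖B‖ with hβdef
  set c := g / (g - 2 * β) with hc
  set ψ : n → ℂ := ⇑(hK.eigenvectorBasis i₀) with hψ
  set R := hK.cfc (fun x => (x - E₀)⁻¹) with hR
  set P := vecMulVec ψ (star ψ) with hPdef
  set M := hK.cfc (fun x => x - E₀ - 2 * β + 2 * β * (if x = E₀ then 1 else 0)) with hM
  set S := hK.cfc (fun x => if x = E₀ then 0 else (x - E₀ - 2 * β)⁻¹) with hS
  have hβ : 0 ≤ β := norm_nonneg B
  have hψ1 : star ψ ⬝ᵥ ψ = 1 := by rw [hψ, star_eigenvectorBasis_dotProduct, if_pos rfl]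
  have hKψ : K *ᵥ ψ = (E₀ : ℂ) • ψ := by
    rw [hψ, hK.mulVec_eigenvectorBasis, hi₀, RCLike.real_smul_eq_coe_smul (K := ℂ)]
    rfl
  have hMpsd : M.PosSemidef := posSemidef_shifted hK hg hi₀ hgap' hBg
  have hMeq : M = K - ((E₀ + 2 * β : ℝ) : ℂ) • (1 : Matrix n n ℂ) + ((2 * β : ℝ) : ℂ) • P :=
    shifted_eq hK hg hi₀ hgap' β
  have hMS : M * S = 1 - P := shifted_mul_partialInv hK hg hi₀ hgap' hBg
  have hSherm : S.IsHermitian := (posSemidef_partialInv hK hg hi₀ hgap' hBg).1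
  have hSψ : S *ᵥ ψ = 0 := partialInv_mulVec_ground hK hi₀ β
  have hcRS : (((c : ℝ) : ℂ) • R - S).PosSemidef :=
    posSemidef_smul_resolvent_sub_partialInv hK hg hi₀ hgap' hβ hBg
  have hRpsd : R.PosSemidef := posSemidef_resolvent hK
  set b := (K.groundStateFunctional B).re with hb
  set q := (K.groundStateFunctional (B * R * B)).re with hq
  have hq0 : 0 ≤ q := by
    have := groundStateFunctional_nonneg_of_posSemidef K (hRpsd.conjTranspose_mul_mul_same B)
    rw [hB.eq] at this
    exact (Complex.nonneg_iff.mp this).1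
  have hc0 : 0 ≤ c := div_nonneg hg.le (by linarith)
  set v := B *ᵥ ψ with hv
  have hbv : (star ψ ⬝ᵥ v).re = b := by rw [hb, hω B]
  have hb' : -β ≤ b := by
    have := neg_norm_mul_re_le hB ψ
    rw [hψ1, Complex.one_re, mul_one, ← hv, hbv] at this
    exact this
  have hqv : (star v ⬝ᵥ (R *ᵥ v)).re = q := by
    rw [hv, star_mulVec_dotProduct, hB.eq, mulVec_mulVec, mulVec_mulVec, ← hω]
  have key : ∀ χ : n → ℂ,
      (E₀ - b - c * q) * (star χ ⬝ᵥ χ).re ≤ (star χ ⬝ᵥ ((K - B) *ᵥ χ)).re := by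
    intro χ
    set α : ℂ := star ψ ⬝ᵥ χ with hα
    set φ : n → ℂ := χ - α • ψ with hφ
    have hχ : χ = φ + α • ψ := by rw [hφ, sub_add_cancel]
    have hψφ : star ψ ⬝ᵥ φ = 0 := by
      rw [hφ, dotProduct_sub, dotProduct_smul, hψ1, smul_eq_mul, mul_one, sub_self]
    have hφψ : star φ ⬝ᵥ ψ = 0 := by rw [star_dotProduct, hψφ, star_zero]
    set η := S *ᵥ v with hη
    set δ := M *ᵥ η with hδ
    have hδv : δ = v - (star ψ ⬝ᵥ v) • ψ := by
      rw [hδ, hη, mulVec_mulVec, hMS, sub_mulVec, one_mulVec, hPdef, vecMulVec_mulVec,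
        op_smul_eq_smul]
    have hφδ : star φ ⬝ᵥ v = star φ ⬝ᵥ δ := by
      rw [hδv, dotProduct_sub, dotProduct_smul, hφψ, smul_zero, sub_zero]
    have hηδ : star η ⬝ᵥ δ = star v ⬝ᵥ (S *ᵥ v) := by
      rw [hδv, dotProduct_sub, dotProduct_smul, hη, star_mulVec_dotProduct S v v,
        star_mulVec_dotProduct S v ψ, hSherm.eq, hSψ, dotProduct_zero, smul_zero, sub_zero]
    have e1 := re_quadratic_add_smul (isHermitian_one : (1 : Matrix n n ℂ).IsHermitian) φ ψ α
    simp only [one_mulVec] at e1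
    rw [← hχ] at e1
    simp only [hφψ, hψ1, mul_zero, Complex.zero_re, add_zero, Complex.one_re, mul_one] at e1
    have e2 := re_quadratic_add_smul hK φ ψ α
    rw [← hχ, hKψ] at e2
    simp only [dotProduct_smul, hφψ, hψ1, mul_zero, Complex.zero_re, add_zero,
      smul_eq_mul, mul_one, Complex.ofReal_re] at e2
    have e3 := re_quadratic_add_smul hB φ ψ α
    rw [← hχ, ← hv, hφδ, hbv] at e3
    have e4 := re_quadratic_add_smul hMpsd.1 φ η (-α)
    rw [← hδ, hηδ, Complex.normSq_neg, neg_mul, Complex.neg_re] at e4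
    have e5 : (star φ ⬝ᵥ (M *ᵥ φ)).re =
        (star φ ⬝ᵥ (K *ᵥ φ)).re - (E₀ + 2 * β) * (star φ ⬝ᵥ φ).re := by
      rw [hMeq, add_mulVec, sub_mulVec, smul_mulVec, smul_mulVec, one_mulVec, hPdef,
        vecMulVec_mulVec, op_smul_eq_smul, hψφ, zero_smul, smul_zero, add_zero, dotProduct_sub,
        dotProduct_smul, Complex.sub_re, smul_eq_mul, Complex.re_ofReal_mul]
    have i1 : 0 ≤ (star (φ + -α • η) ⬝ᵥ (M *ᵥ (φ + -α • η))).re := by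
      have := hMpsd.re_dotProduct_nonneg (φ + -α • η)
      rwa [RCLike.re_to_complex] at this
    have i2 := re_le_of_posSemidef_smul_sub hcRS v
    rw [hqv] at i2
    have i3 : (star φ ⬝ᵥ (B *ᵥ φ)).re ≤ β * (star φ ⬝ᵥ φ).re := by
      have := neg_norm_mul_re_le hB.neg φ
      rw [norm_neg, neg_mulVec, dotProduct_neg, Complex.neg_re] at this
      linarith
    have i4 : 0 ≤ (star φ ⬝ᵥ φ).re := (Complex.nonneg_iff.mp (dotProduct_star_self_nonneg φ)).1
    have i5 : 0 ≤ Complex.normSq α := Complex.normSq_nonneg α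
    have p1 : Complex.normSq α * (star v ⬝ᵥ (S *ᵥ v)).re ≤ Complex.normSq α * (c * q) :=
      mul_le_mul_of_nonneg_left i2 i5
    have p2 : 0 ≤ (star φ ⬝ᵥ φ).re * (β + b) := mul_nonneg i4 (by linarith)
    have p3 : 0 ≤ (star φ ⬝ᵥ φ).re * (c * q) := mul_nonneg i4 (mul_nonneg hc0 hq0)
    rw [re_quadratic_sub, e1, e2, e3]
    linarith [e4, e5, i1, i3, p1, p2, p3]
  have hA : (K - B).IsHermitian := hK.sub hB
  rw [← minEnergyOn_top_holds hA]
  refine le_csInf ⟨_, ψ, Submodule.mem_top, hψ1, rfl⟩ ?_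
  rintro E ⟨χ, -, hχ1, rfl⟩
  have := key χ
  rwa [hχ1, Complex.one_re, mul_one] at this

/-- **Upper bound** `E₀(K - B) ≤ E₀ - (ω(B) + ω(BRB) - ‖B‖ω(BR²B))/(1 + ω(BR²B))`: the trial
vector `ψ + RBψ` in the variational principle, with `(K - E₀)R = 1 - |ψ⟩⟨ψ|`, `Rψ = 0`. [folklore] -/
theorem upper_bound [Nonempty n] {R : Matrix n n ℂ} (hR : R = hK.cfc (fun x => (x - K.groundEnergy)⁻¹))
    (hg : 0 < g) (hi₀ : hK.eigenvalues i₀ = K.groundEnergy)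
    (hgap' : ∀ i, i ≠ i₀ → K.groundEnergy + g ≤ hK.eigenvalues i)
    (hω : ∀ X, K.groundStateFunctional X =
      star ⇑(hK.eigenvectorBasis i₀) ⬝ᵥ (X *ᵥ ⇑(hK.eigenvectorBasis i₀)))
    {B : Matrix n n ℂ} (hB : B.IsHermitian) :
    (K - B).groundEnergy ≤ K.groundEnergy -
      ((K.groundStateFunctional B).re + (K.groundStateFunctional (B * R * B)).re -
        ‖B‖ * (K.groundStateFunctional (B * R * R * B)).re) /
      (1 + (K.groundStateFunctional (B * R * R * B)).re) := by
  subst hR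
  set E₀ := K.groundEnergy with hE₀
  set ψ : n → ℂ := ⇑(hK.eigenvectorBasis i₀) with hψ
  set R := hK.cfc (fun x => (x - E₀)⁻¹) with hR
  set P := vecMulVec ψ (star ψ) with hPdef
  have hψ1 : star ψ ⬝ᵥ ψ = 1 := by rw [hψ, star_eigenvectorBasis_dotProduct, if_pos rfl]
  have hKψ : K *ᵥ ψ = (E₀ : ℂ) • ψ := by
    rw [hψ, hK.mulVec_eigenvectorBasis, hi₀, RCLike.real_smul_eq_coe_smul (K := ℂ)]
    rfl
  have hRpsd : R.PosSemidef := posSemidef_resolvent hK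
  have hRherm : R.IsHermitian := hRpsd.1
  have hRψ : R *ᵥ ψ = 0 := resolvent_mulVec_ground hK hi₀
  have hKR : K * R = ((E₀ : ℝ) : ℂ) • R + (1 - P) := hamiltonian_mul_resolvent hK hg hi₀ hgap'
  set b := (K.groundStateFunctional B).re with hb
  set q := (K.groundStateFunctional (B * R * B)).re with hq
  set ρ := (K.groundStateFunctional (B * R * R * B)).re with hρ
  have hρ0 : 0 ≤ ρ := by
    have := groundStateFunctional_nonneg_of_posSemidef K
      (posSemidef_conjTranspose_mul_self (R * B))
    rw [conjTranspose_mul, hB.eq, hRherm.eq, ← Matrix.mul_assoc] at this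
    exact (Complex.nonneg_iff.mp this).1
  set v := B *ᵥ ψ with hv
  set w := R *ᵥ v with hw
  have hbv : (star ψ ⬝ᵥ v).re = b := by rw [hb, hω B]
  have hqv : (star v ⬝ᵥ w).re = q := by
    rw [hq, hω, hw, hv, star_mulVec_dotProduct, hB.eq, mulVec_mulVec, mulVec_mulVec]
  have hρv : (star w ⬝ᵥ w).re = ρ := by
    rw [hρ, hω, hw, hv, star_mulVec_dotProduct, star_mulVec_dotProduct, hB.eq, hRherm.eq,
      mulVec_mulVec, mulVec_mulVec, mulVec_mulVec]
  have hψw : star ψ ⬝ᵥ w = 0 := by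
    rw [hw, ← hRherm.eq, ← star_mulVec_dotProduct, hRψ, star_zero, zero_dotProduct]
  have hwψ : star w ⬝ᵥ ψ = 0 := by rw [star_dotProduct, hψw, star_zero]
  have hψBw : (star ψ ⬝ᵥ (B *ᵥ w)).re = q := by
    rw [← hqv, hv, star_mulVec_dotProduct, hB.eq]
  have hwv : (star w ⬝ᵥ v).re = q := by
    rw [star_dotProduct, Complex.star_def, Complex.conj_re, hqv]
  have hKw : K *ᵥ w = (E₀ : ℂ) • w + (v - (star ψ ⬝ᵥ v) • ψ) := by
    rw [hw, mulVec_mulVec, hKR, add_mulVec, smul_mulVec, sub_mulVec, one_mulVec, hPdef,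
      vecMulVec_mulVec, op_smul_eq_smul]
  have e1 := re_quadratic_add_smul (isHermitian_one : (1 : Matrix n n ℂ).IsHermitian) ψ w 1
  simp only [one_mulVec, one_smul, one_mul, map_one, hψ1, hψw, Complex.one_re,
    Complex.zero_re, mul_zero, add_zero, hρv] at e1
  have e2 := re_quadratic_add_smul hK ψ w 1
  rw [one_smul, hKψ, hKw] at e2
  simp only [one_mul, map_one, dotProduct_add, dotProduct_sub, dotProduct_smul, hψ1, hψw,
    hwψ, smul_eq_mul, mul_one, mul_zero, sub_zero, Complex.add_re, Complex.ofReal_re, sub_self,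
    Complex.zero_re, add_zero, Complex.re_ofReal_mul, hρv, hwv] at e2
  have e3 := re_quadratic_add_smul hB ψ w 1
  rw [one_smul, ← hv] at e3
  simp only [one_mul, map_one, hbv, hψBw] at e3
  have i1 := neg_norm_mul_re_le hB w
  rw [hρv] at i1
  have hvar := groundEnergy_mul_re_le (hK.sub hB) (ψ + w)
  rw [re_quadratic_sub, e1, e2, e3] at hvar
  have hpos : 0 < 1 + ρ := by linarith
  rw [le_sub_comm, div_le_iff₀ hpos]
  nlinarith [hvar, i1]

end Clauses

end CwSecondOrder

open CwSecondOrder in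
/-- **Stub `stub_secondOrderEnergyBounds`** of the lead's skeleton (crux `CwChiralConstruction`, line
`susceptibility-rise-budget`): two-sided second-order perturbation bounds at a unique gapped ground
state. For Hermitian `K` with `K.HasSpectralGap g` there is a Hermitian `R` (the reduced resolvent
`Σ_{λ ≠ E₀} (λ - E₀)⁻¹ P_λ`) with `0 ≤ ω(XᴴRX) ≤ (ω(XᴴX) - |ω X|²)/g`, `ω(XᴴR²X) ≤ ω(XᴴRX)/g`, and
for every Hermitian `B` with `2‖B‖ < g`:
`E₀ - ω(B) - (g/(g - 2‖B‖)) ω(BRB) ≤ E₀(K - B) ≤ E₀ - (ω(B) + ω(BRB) - ‖B‖ω(BR²B))/(1 + ω(BR²B))`.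
[folklore: Rayleigh–Schrödinger / Kato, Temple-type bounds] -/
theorem stub_secondOrderEnergyBounds :
    ∀ {n : Type} [Fintype n] [DecidableEq n] [Nonempty n] (K : Matrix n n ℂ) (g : ℝ), K.IsHermitian → 0 < g → K.HasSpectralGap g → ∃ R : Matrix n n ℂ, R.IsHermitian ∧ (∀ X : Matrix n n ℂ, 0 ≤ (K.groundStateFunctional (Xᴴ * R * X)).re) ∧ (∀ X : Matrix n n ℂ, (K.groundStateFunctional (Xᴴ * R * X)).re ≤ ((K.groundStateFunctional (Xᴴ * X)).re - ‖K.groundStateFunctional X‖ ^ 2) / g) ∧ (∀ X : Matrix n n ℂ, (K.groundStateFunctional (Xᴴ * R * R * X)).re ≤ (K.groundStateFunctional (Xᴴ * R * X)).re / g) ∧ ∀ B : Matrix n n ℂ, B.IsHermitian → 2 * ‖B‖ < g → K.groundEnergy - (K.groundStateFunctional B).re - g / (g - 2 * ‖B‖) * (K.groundStateFunctional (B * R * B)).re ≤ (K - B).groundEnergy ∧ (K - B).groundEnergy ≤ K.groundEnergy - ((K.groundStateFunctional B).re + (K.groundStateFunctional (B * R * B)).re - ‖B‖ * (K.groundStateFunctional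 (B * R * R * B)).re) / (1 + (K.groundStateFunctional (B * R * R * B)).re) := by
  intro n _ _ _ K g hK hg hgap
  obtain ⟨i₀, hi₀, hgap'⟩ := exists_ground_index hK hgap
  have hP := groundProj_eq_vecMulVec hK hgap hi₀
  have hψ1 : star ⇑(hK.eigenvectorBasis i₀) ⬝ᵥ ⇑(hK.eigenvectorBasis i₀) = 1 := by
    rw [star_eigenvectorBasis_dotProduct, if_pos rfl]
  have hω := groundStateFunctional_eq_of_groundProj hP hψ1
  refine ⟨hK.cfc (fun x => (x - K.groundEnergy)⁻¹), (posSemidef_resolvent hK).1,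
    re_conj_resolvent_nonneg hK, re_conj_resolvent_le hK rfl hg hi₀ hgap' hω,
    re_conj_resolvent_sq_le hK rfl hg hi₀ hgap', fun B hB hBg => ⟨?_, ?_⟩⟩
  · exact lower_bound hK rfl hg hi₀ hgap' hω hB hBg
  · exact upper_bound hK rfl hg hi₀ hgap' hω hB

end Summit.HubbardSuperconductivity.HubbardSuperconductivity.Theorems
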